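import Mathlib
import Literature.Analysis.OperatorTheory.ContractiveDetComplexity
import Literature.Analysis.OperatorTheory.ContractiveDeterminantalRepresentations
import HarnessLib

/-!
# Crux `PriceOfContractivity` (stmt-ValiantsHypothesis-10583), line `birth` — stub
# `stub_stableLifting_twoColour` (♦, stable determinantal lifting, the TWO-COLOUR case)

Route `ValiantsHypothesis/ContractivityPrice`, crux K1
(`Summit.ValiantsHypothesis.ValiantsHypothesis.Theses.ContractivityPrice.PriceOfContractivity`).
The open stub `stub_stableLifting` (♦) of the lead's skeleton (line `birth`, rev 5) asks: a
Sylvester pencil `1 + diag (X ∘ κ) · K₀` of size `R ≤ 2 ^ L` whose determinant has no zero on the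
closed polydisc of radius `2` is re-realized, at size `R₁ ≤ 2 ^ ((L+d)^d)`, by a matrix `K₁` all of
whose principal minors `det K₁[w]` (`w : Fin (k+1) ↪ Fin R₁`) have modulus
`≤ (2 ^ ((L+d)^d)) ^ (k+1)`.

This file proves the registered stub `stub_stableLifting_twoColour`: the case of AT MOST TWO
COLOURS (`κ` takes at most two values), with the published two-variable theorem of
Grinshpan–Kaliuzhnyi-Verbovetskyi–Vinnikov–Woerdeman [GrinshpanEtAl2014, Thm. 2.1] INLINED AS AN
EXPLICIT HYPOTHESIS of the statement (it is not proved in the tree).  In the route's Sylvester form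
that hypothesis reads: every non-constant `p : MvPolynomial (Fin 2) ℂ` with `p(0) = 1` and no zero
in the open polydisc `r𝔻²` (`r > 0`) is `det (1 + diag (X ∘ κ) · K)` for some
`K : Matrix (Fin (deg₀ p + deg₁ p)) (Fin (deg₀ p + deg₁ p)) ℂ` with `‖K‖_op ≤ r⁻¹` and a colouring
`κ` with `#κ⁻¹(j) = deg_j p` (the paper's `p = det (I − K Z_n)`, `Z_n = z₁ I_{n₁} ⊕ z₂ I_{n₂}`,
`n = deg p` the bidegree, `‖K‖ = s(p)⁻¹` the inverse stability radius; `K ↦ −K` and Sylvester's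
identity put it in the form `det (1 + Z (−K))`, and `r ≤ s(p)` weakens `= s(p)⁻¹` to `≤ r⁻¹`).

Proof.  With two colours `a, b` the pencil determinant is (a renaming `Fin 2 → σ` of) a bivariate
polynomial `p̂(x, y)` with `p̂(0,0) = 1`, total degree `≤ R` (affine entries, Leibniz) and no zero
on the closed — hence open — radius-`2` bidisc.  If `p̂` is constant it is `1` and the EMPTY
matrix realizes it.  Otherwise the hypothesis at `r = 2` re-realizes it as
`det (1 + diag (X ∘ κ̂) · K)` of size `deg₀ p̂ + deg₁ p̂ ≤ 2R ≤ 2 ^ (L+1)` with `‖K‖_op ≤ 1/2`;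
renaming back gives the pencil identity over `σ`.  The entries of `K` are `≤ ‖K‖_op ≤ 1/2 ≤ 1`,
so every `(k+1) × (k+1)` principal minor is at most
`(k+1)! ≤ (k+1)^(k+1) ≤ R₁^(k+1) ≤ (2 ^ (L+1))^(k+1)` in modulus (Leibniz), and `d = 1` works.
The general (three or more colours) case of ♦ is open.

## References

* [GrinshpanEtAl2014] A. Grinshpan, D. S. Kaliuzhnyi-Verbovetskyi, V. Vinnikov, H. J. Woerdeman,
  Stable and real-zero polynomials in two variables, Multidimens. Syst. Signal Process. 27 (2016)
  1–26 = arXiv:1306.6655: §1 (conventions: `𝔻²`, bidegree `deg p = (deg₁ p, deg₂ p)`,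
  representation (1.1) `p = det (I_{|n|} − K Z_n)`, `Z_n = z₁ I_{n₁} ⊕ z₂ I_{n₂}`), §2 first display
  (stability radius `s(p) := max {r > 0 : p(z) ≠ 0, z ∈ r𝔻²}`), Theorem 2.1 (p. 4): "Let
  `p(z₁, z₂)`, with `p(0, 0) = 1`, be a non-constant bivariate polynomial. Then `p` admits a
  representation (1.1) with `n = deg p` and `‖K‖ = s(p)⁻¹`."
-/

noncomputable section

-- `Summit.<Summit>.<Problem>` repeats `ValiantsHypothesis` by the tree's layout convention (D-0017).
set_option linter.dupNamespace false

namespace Summit.ValiantsHypothesis.ValiantsHypothesis.Theorems.PriceOfContractivity.StableLifting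

open Matrix MvPolynomial
open Literature.Analysis.OperatorTheory (eval_det_one_add_diagonal_mul_map_C
  totalDegree_one_add_diagonal_mul_map_C_apply_le)

/-! ### Bookkeeping lemmas -/

/-- Renaming variables in a Sylvester pencil determinant renames the colouring:
`rename g (det (1 + diag (X ∘ κ) K)) = det (1 + diag (X ∘ g ∘ κ) K)`. [folklore] -/
theorem rename_pencil_det {τ σ : Type} {n : Type} [Fintype n] [DecidableEq n]
    (g : τ → σ) (K : Matrix n n ℂ) (κ : n → τ) :
    MvPolynomial.rename g
        (1 + Matrix.diagonal (fun i => MvPolynomial.X (κ i)) *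
          K.map (fun a : ℂ => (MvPolynomial.C a : MvPolynomial τ ℂ))).det =
      (1 + Matrix.diagonal (fun i => MvPolynomial.X (g (κ i))) *
          K.map (fun a : ℂ => (MvPolynomial.C a : MvPolynomial σ ℂ))).det := by
  rw [AlgHom.map_det, map_add, map_one, map_mul, AlgHom.mapMatrix_apply, AlgHom.mapMatrix_apply,
    diagonal_map (map_zero _), Matrix.map_map]
  simp [Function.comp_def, rename_X]

/-- Leibniz degree bound for the Sylvester pencil: `det (1 + diag (X ∘ κ) K)` has total degree at
most the size of `K` (every entry is affine). [folklore]
-- adapted from Literature.LinearAlgebra.Matrix.totalDegree_det_le -/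
theorem totalDegree_pencil_det_le {σ : Type} {n : Type} [Fintype n] [DecidableEq n]
    (K : Matrix n n ℂ) (κ : n → σ) :
    (1 + Matrix.diagonal (fun i => MvPolynomial.X (κ i)) *
        K.map (fun a : ℂ => (MvPolynomial.C a : MvPolynomial σ ℂ))).det.totalDegree ≤
      Fintype.card n := by
  set M := (1 + Matrix.diagonal (fun i => MvPolynomial.X (κ i)) *
        K.map (fun a : ℂ => (MvPolynomial.C a : MvPolynomial σ ℂ))) with hM
  have hent : ∀ i j, (M i j).totalDegree ≤ 1 := fun i j =>
    totalDegree_one_add_diagonal_mul_map_C_apply_le K κ i j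
  rw [det_apply']
  refine (totalDegree_finsetSum _ _).trans (Finset.sup_le fun τ _ => ?_)
  refine (totalDegree_mul _ _).trans ?_
  have h0 : ((Equiv.Perm.sign τ : ℤ) : MvPolynomial σ ℂ).totalDegree = 0 := by
    rw [← map_intCast (C : ℂ →+* MvPolynomial σ ℂ), totalDegree_C]
  rw [h0, zero_add]
  calc (∏ i, M (τ i) i).totalDegree ≤ ∑ i, (M (τ i) i).totalDegree := totalDegree_finsetProd _ _
    _ ≤ ∑ _i : n, 1 := Finset.sum_le_sum fun i _ => hent _ _
    _ = Fintype.card n := by simp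

open scoped Matrix.Norms.L2Operator in
/-- Every entry of a square complex matrix is bounded by its operator `(2,2)`-norm. [folklore]
-- adapted from Literature.Computability.QuantumComplexity.PathModelEncodedIntertwiners.norm_apply_le_l2_opNorm -/
theorem norm_apply_le_norm_toEuclideanCLM {N : ℕ} (A : Matrix (Fin N) (Fin N) ℂ) (i j : Fin N) :
    ‖A i j‖ ≤ ‖Matrix.toEuclideanCLM (𝕜 := ℂ) A‖ := by
  rw [Matrix.l2_opNorm_toEuclideanCLM]
  have h := Matrix.l2_opNorm_mulVec A (EuclideanSpace.single j (1 : ℂ))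
  have h1 : ‖(EuclideanSpace.single j (1 : ℂ))‖ = 1 := by simp
  rw [h1, mul_one] at h
  refine le_trans ?_ h
  refine le_trans (le_of_eq ?_) (PiLp.norm_apply_le _ i)
  simp

/-- Leibniz bound on a principal minor: if all entries of `A` have modulus `≤ 1` then every
`(k+1) × (k+1)` submatrix determinant has modulus `≤ (k+1)!`. [folklore] -/
theorem norm_det_submatrix_le_factorial {N k : ℕ} (A : Matrix (Fin N) (Fin N) ℂ)
    (hA : ∀ i j, ‖A i j‖ ≤ 1) (w : Fin (k + 1) → Fin N) :
    ‖(A.submatrix w w).det‖ ≤ (Nat.factorial (k + 1) : ℝ) := by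
  have h := Matrix.det_le (A := A.submatrix w w) (abv := NormedField.toAbsoluteValue ℂ) (x := (1 : ℝ))
    (fun i j => by simpa [NormedField.toAbsoluteValue] using hA (w i) (w j))
  simpa [NormedField.toAbsoluteValue, Fintype.card_fin] using h

/-- Arithmetic: `(k+1)! ≤ (2 ^ (L+1)) ^ (k+1)` as soon as `k + 1 ≤ R₁ ≤ 2 ^ (L+1)`. [folklore] -/
theorem factorial_le_pow_pow {k R₁ L : ℕ} (hk : k + 1 ≤ R₁) (hR : R₁ ≤ 2 ^ ((L + 1) ^ 1)) :
    (Nat.factorial (k + 1) : ℝ) ≤ ((2 : ℝ) ^ ((L + 1) ^ 1)) ^ (k + 1) := by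
  have h : Nat.factorial (k + 1) ≤ (2 ^ ((L + 1) ^ 1)) ^ (k + 1) :=
    calc Nat.factorial (k + 1) ≤ (k + 1) ^ (k + 1) := Nat.factorial_le_pow _
      _ ≤ R₁ ^ (k + 1) := Nat.pow_le_pow_left hk _
      _ ≤ (2 ^ ((L + 1) ^ 1)) ^ (k + 1) := Nat.pow_le_pow_left hR _
  exact_mod_cast h

/-! ### The two-colour case of `stub_stableLifting` -/

/-- **Two-colour case of the stable determinantal lifting (stub ♦), conditional on
[GrinshpanEtAl2014, Thm. 2.1] taken as the explicit first hypothesis** (Grinshpan,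
Kaliuzhnyi-Verbovetskyi, Vinnikov, Woerdeman, *Stable and real-zero polynomials in two variables*,
Thm. 2.1: "Let `p(z₁, z₂)`, with `p(0, 0) = 1`, be a non-constant bivariate polynomial. Then `p`
admits a representation `p = det (I_{|n|} − K Z_n)` with `n = deg p` and `‖K‖ = s(p)⁻¹`", here in
the route's Sylvester form `det (1 + diag (X ∘ κ) · K)`, `#κ⁻¹(j) = deg_j p`, `‖K‖_op ≤ r⁻¹` for
every zero-free radius `r`).  If the colouring `κ` takes at most two values `a, b`, then the
pencil determinant is (a renaming of) a bivariate polynomial `p̂` with `p̂(0) = 1` and no zero on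
the polydisc of radius `2`; unless `p̂` is constant (then `p̂ = 1` and the empty matrix realizes
it), the hypothesis gives `p̂ = det (1 + diag (X ∘ κ̂) K)` with `‖K‖ ≤ 1/2` at size
`deg₀ p̂ + deg₁ p̂ ≤ 2R ≤ 2 ^ (L+1)`, and renaming back gives the re-realization; all entries of
`K` are `≤ 1/2 ≤ 1`, so every `(k+1)`-minor is `≤ (k+1)! ≤ (2 ^ (L+1)) ^ (k+1)`: the registered
conclusion with `d = 1`. [cite: GrinshpanEtAl2014, Thm. 2.1] -/
theorem stub_stableLifting_twoColour :
    (∀ (p : MvPolynomial (Fin 2) ℂ) (r : ℝ), 0 < r →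
      MvPolynomial.eval (0 : Fin 2 → ℂ) p = 1 → 0 < p.totalDegree →
      (∀ z : Fin 2 → ℂ, (∀ j, ‖z j‖ < r) → MvPolynomial.eval z p ≠ 0) →
      ∃ (K : Matrix (Fin (p.degreeOf 0 + p.degreeOf 1)) (Fin (p.degreeOf 0 + p.degreeOf 1)) ℂ)
        (κ : Fin (p.degreeOf 0 + p.degreeOf 1) → Fin 2),
        (∀ j : Fin 2, (Finset.univ.filter fun i => κ i = j).card = p.degreeOf j) ∧
        ‖Matrix.toEuclideanCLM (𝕜 := ℂ) K‖ ≤ r⁻¹ ∧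
        p = (1 + Matrix.diagonal (fun i => MvPolynomial.X (κ i)) *
              K.map (fun a : ℂ => (MvPolynomial.C a : MvPolynomial (Fin 2) ℂ))).det) →
    ∃ d : ℕ, ∀ (L R : ℕ) {σ : Type} (K₀ : Matrix (Fin R) (Fin R) ℂ) (κ : Fin R → σ),
      (∃ a b : σ, ∀ i, κ i = a ∨ κ i = b) →
      R ≤ 2 ^ L →
      (∀ z : σ → ℂ, (∀ j, ‖z j‖ ≤ 2) → MvPolynomial.eval z (1 + Matrix.diagonal (fun i => MvPolynomial.X (κ i)) * K₀.map (fun a : ℂ => (MvPolynomial.C a : MvPolynomial σ ℂ))).det ≠ 0) →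
      ∃ R₁ ≤ 2 ^ ((L + d) ^ d), ∃ (K₁ : Matrix (Fin R₁) (Fin R₁) ℂ) (κ₁ : Fin R₁ → σ),
        (∀ (k : ℕ) (w : Fin (k + 1) → Fin R₁), Function.Injective w →
          ‖(K₁.submatrix w w).det‖ ≤ ((2 : ℝ) ^ ((L + d) ^ d)) ^ (k + 1)) ∧
        (1 + Matrix.diagonal (fun i => MvPolynomial.X (κ i)) * K₀.map (fun a : ℂ => (MvPolynomial.C a : MvPolynomial σ ℂ))).det =
          (1 + Matrix.diagonal (fun i => MvPolynomial.X (κ₁ i)) * K₁.map (fun a : ℂ => (MvPolynomial.C a : MvPolynomial σ ℂ))).det := by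
  intro hGKVVW
  classical
  refine ⟨1, ?_⟩
  intro L R σ K₀ κ h2 hR hz
  obtain ⟨a, b, hab⟩ := h2
  -- comparison maps between `σ` and `Fin 2`
  let f : σ → Fin 2 := fun s => if s = a then 0 else 1
  let g : Fin 2 → σ := fun j => if j = 0 then a else b
  have hgf : ∀ i, g (f (κ i)) = κ i := by
    intro i
    rcases hab i with h | h
    · simp [f, g, h]
    · by_cases hba : b = a
      · simp [f, g, h, hba]
      · simp [f, g, h, hba]
  -- the pencil determinant and its two-variable avatar
  set P := (1 + Matrix.diagonal (fun i => MvPolynomial.X (κ i)) *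
      K₀.map (fun a : ℂ => (MvPolynomial.C a : MvPolynomial σ ℂ))).det with hP
  set q := (1 + Matrix.diagonal (fun i => MvPolynomial.X (f (κ i))) *
      K₀.map (fun a : ℂ => (MvPolynomial.C a : MvPolynomial (Fin 2) ℂ))).det with hq
  have hPq : P = MvPolynomial.rename g q := by
    rw [hq, rename_pencil_det]
    simp only [hgf]
    exact hP
  have hq0 : MvPolynomial.eval (0 : Fin 2 → ℂ) q = 1 := by
    rw [hq, eval_det_one_add_diagonal_mul_map_C]
    simp
  have hqz : ∀ zh : Fin 2 → ℂ, (∀ j, ‖zh j‖ < 2) → MvPolynomial.eval zh q ≠ 0 := by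
    intro zh hzh
    have h := hz (zh ∘ f) (fun j => (hzh (f j)).le)
    rw [hP, eval_det_one_add_diagonal_mul_map_C] at h
    rw [hq, eval_det_one_add_diagonal_mul_map_C]
    simpa [Function.comp_def] using h
  have hqdeg : q.totalDegree ≤ R := by
    simpa [Fintype.card_fin] using totalDegree_pencil_det_le K₀ (fun i => f (κ i))
  by_cases hconst : q.totalDegree = 0
  · -- constant case: `q = 1`, realized by the empty matrix
    have hq1 : q = 1 := by
      have hc : q = MvPolynomial.C (q.coeff 0) := totalDegree_eq_zero_iff_eq_C.mp hconst
      rw [hc] at hq0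
      rw [MvPolynomial.eval_C] at hq0
      rw [hc, hq0, MvPolynomial.C_1]
    refine ⟨0, Nat.zero_le _, (0 : Matrix (Fin 0) (Fin 0) ℂ), Fin.elim0, ?_, ?_⟩
    · intro k w _
      exact Fin.elim0 (w 0)
    · rw [hPq, hq1, map_one, Matrix.det_isEmpty]
  · -- non-constant case: the two-variable theorem at radius `r = 2`
    obtain ⟨K, κq, _hcard, hK, hrepr⟩ :=
      hGKVVW q 2 two_pos hq0 (Nat.pos_of_ne_zero hconst) hqz
    have hN : q.degreeOf 0 + q.degreeOf 1 ≤ 2 ^ ((L + 1) ^ 1) := by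
      have h0 := (degreeOf_le_totalDegree q 0).trans hqdeg
      have h1 := (degreeOf_le_totalDegree q 1).trans hqdeg
      calc q.degreeOf 0 + q.degreeOf 1 ≤ R + R := Nat.add_le_add h0 h1
        _ ≤ 2 ^ L + 2 ^ L := Nat.add_le_add hR hR
        _ = 2 ^ ((L + 1) ^ 1) := by rw [pow_one, pow_succ]; ring
    have hent : ∀ i j, ‖K i j‖ ≤ 1 := fun i j =>
      ((norm_apply_le_norm_toEuclideanCLM K i j).trans hK).trans (by norm_num)
    refine ⟨q.degreeOf 0 + q.degreeOf 1, hN, K, fun i => g (κq i), ?_, ?_⟩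
    · intro k w hw
      have hk : k + 1 ≤ q.degreeOf 0 + q.degreeOf 1 := by
        simpa [Fintype.card_fin] using Fintype.card_le_of_injective w hw
      exact (norm_det_submatrix_le_factorial K hent w).trans (factorial_le_pow_pow hk hN)
    · rw [hPq, ← rename_pencil_det g K κq]
      exact congrArg (MvPolynomial.rename g) hrepr

end Summit.ValiantsHypothesis.ValiantsHypothesis.Theorems.PriceOfContractivity.StableLifting
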